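import Literature.RingTheory.MvPowerSeries.EvalAnalytic
import Mathlib.Analysis.Analytic.Constructions
import Mathlib.Analysis.Analytic.Linear
import Mathlib.Analysis.Complex.Basic
import HarnessLib

/-!
# Division of analytic functions by a coordinate

Topic `Literature/RingTheory/MvPowerSeries`.  The several-variable **division lemma along a
coordinate hyperplane**: an analytic function `f` of finitely many variables over a complete
nontrivially normed field `𝕜` which vanishes on the hyperplane `{xᵢ = 0}` is `f = xᵢ · h` with `h`
analytic (H. Grauert, R. Remmert, *Analytische Stellenalgebren* (1971), Kap. I §3 — the case of
the distinguished "polynomial" `xᵢ` of the Weierstrass division theorem; J. M. Ruiz, *The basic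
theory of power series* (1993), §3).  It is proved in four layers.

* **Power series** (`exists_eq_X_mul_add`, `exists_eval_eq_coord_mul_add`): every `f ∈ 𝕜⟦X⟧`
  splits as `f = Xᵢ · q + r` with the quotient `q = ∑_α f_{α+eᵢ} X^α` and the restriction
  `r = f(Xᵢ := 0) = ∑_{αᵢ = 0} f_α X^α`; for the weighted norms of `ConvergentPowerSeries.lean`
  one has `‖q‖_ρ ρᵢ ≤ ‖f‖_ρ` and `‖r‖_ρ ≤ ‖f‖_ρ`, and on the closed polydisc
  `f(y) = yᵢ · q(y) + f(y with yᵢ := 0)` (`eval`).  No injectivity of `eval` is used: the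
  restriction is recognised through its *values* on the hyperplane (`eval_restrict`).
* **Locally** (`exists_analyticAt_eventually_eq_coord_mul`): if `f` is analytic at a point `p` of
  the hyperplane and vanishes on the hyperplane near `p`, then `f = xᵢ · h` near `p` with `h`
  analytic at `p` — expand `f(p + y) = P(y)` in a convergent power series
  (`OfAnalytic.lean`, `exists_wnorm_lt_top_eval_eq_of_hasFPowerSeriesOnBall`) and sum the quotient
  series (`EvalAnalytic.lean`, `analyticAt_eval`).
* **On open sets** (`exists_analyticOnNhd_eq_coord_mul`): the local quotients glue with `f / xᵢ`
  off the hyperplane, because two functions continuous at a point and equal off the hyperplane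
  near it agree there (`eq_of_eventually_eq_off_coord`).
* The **`ℂ`-valued real-analytic** case (`exists_analyticOnNhd_eq_ofReal_coord_mul`), by
  splitting into real and imaginary parts.

Everything is proved; there are no definitions (the quotient and restriction series are
characterised by their coefficients) and no named facts.  Not here: division by a general
Weierstrass polynomial (`WeierstrassDivision.lean`), orders of vanishing along a hyperplane.

## References

* [GrauertRemmert1971] H. Grauert, R. Remmert, *Analytische Stellenalgebren*, Springer (1971),
  Kap. I §§1–3.
* [Ruiz1993] J. M. Ruiz, *The basic theory of power series*, Vieweg (1993), §§2–3.
-/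

noncomputable section

open MvPowerSeries Finsupp Filter Function
open scoped NNReal ENNReal Topology BigOperators

namespace Literature.RingTheory.MvPowerSeries

/-! ### 1. Splitting a power series along a variable -/

section Algebra

variable {σ : Type*} {R : Type*} [CommSemiring R]

/-- **Splitting off a variable**: every `f ∈ R⟦X⟧` is `f = Xᵢ · q + r` with the *quotient*
`q = ∑_α f_{α + eᵢ} X^α` and the *restriction* `r = ∑_{α : αᵢ = 0} f_α X^α = f(Xᵢ := 0)`.
[folklore] -/
theorem exists_eq_X_mul_add (i : σ) (f : MvPowerSeries σ R) :
    ∃ q r : MvPowerSeries σ R, (∀ α, coeff α q = coeff (α + single i 1) f) ∧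
      (∀ α, coeff α r = if α i = 0 then coeff α f else 0) ∧ X i * q + r = f := by
  classical
  let q : MvPowerSeries σ R := fun α => coeff (α + single i 1) f
  let r : MvPowerSeries σ R := fun α => if α i = 0 then coeff α f else 0
  have hq : ∀ α, coeff α q = coeff (α + single i 1) f := fun α => rfl
  have hr : ∀ α, coeff α r = if α i = 0 then coeff α f else 0 := fun α => rfl
  refine ⟨q, r, hq, hr, ?_⟩
  ext α
  rw [map_add, X_def, coeff_monomial_mul, one_mul, hq, hr]
  by_cases h : α i = 0
  · have h' : ¬ single i 1 ≤ α := by rw [Finsupp.single_le_iff]; omega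
    rw [if_neg h', if_pos h, zero_add]
  · have h' : single i 1 ≤ α := by rw [Finsupp.single_le_iff]; omega
    rw [if_pos h', if_neg h, add_zero, tsub_add_cancel_of_le h']

end Algebra

/-! ### 2. Norms and sums of the quotient and the restriction -/

section Normed

variable {σ : Type*} {𝕜 : Type*} [NormedField 𝕜]

/-- Coefficientwise domination gives domination of the weighted norms. [folklore] -/
theorem wnorm_le_wnorm_of_nnnorm_coeff_le (ρ : σ → ℝ≥0) {g f : MvPowerSeries σ 𝕜}
    (h : ∀ α, ‖coeff α g‖₊ ≤ ‖coeff α f‖₊) : wnorm ρ g ≤ wnorm ρ f :=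
  ENNReal.tsum_le_tsum fun α => ENNReal.coe_le_coe.2 (mul_le_mul_of_nonneg_right (h α) zero_le)

/-- The restriction `r = f(Xᵢ := 0)` has `‖r‖_ρ ≤ ‖f‖_ρ`. [folklore] -/
theorem wnorm_restrict_le (ρ : σ → ℝ≥0) {i : σ} {r f : MvPowerSeries σ 𝕜}
    (hr : ∀ α, coeff α r = if α i = 0 then coeff α f else 0) : wnorm ρ r ≤ wnorm ρ f := by
  refine wnorm_le_wnorm_of_nnnorm_coeff_le ρ fun α => ?_
  rw [hr α]
  split_ifs
  · exact le_rfl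
  · rw [nnnorm_zero]; exact zero_le

/-- The quotient `q = ∑_α f_{α + eᵢ} X^α` has `‖q‖_ρ · ρᵢ ≤ ‖f‖_ρ`. [folklore] -/
theorem wnorm_quot_mul_le (ρ : σ → ℝ≥0) {i : σ} {q f : MvPowerSeries σ 𝕜}
    (hq : ∀ α, coeff α q = coeff (α + single i 1) f) : wnorm ρ q * ρ i ≤ wnorm ρ f := by
  unfold wnorm
  rw [← ENNReal.tsum_mul_right]
  have h : ∀ α : σ →₀ ℕ, ((‖coeff α q‖₊ * wt ρ α : ℝ≥0) : ℝ≥0∞) * ρ i =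
      ((‖coeff (α + single i 1) f‖₊ * wt ρ (α + single i 1) : ℝ≥0) : ℝ≥0∞) := by
    intro α
    rw [hq α, wt_add, wt_single, pow_one, ← ENNReal.coe_mul, mul_assoc]
  simp_rw [h]
  exact ENNReal.tsum_comp_le_tsum_of_injective (add_left_injective (single i 1))
    (fun β => ((‖coeff β f‖₊ * wt ρ β : ℝ≥0) : ℝ≥0∞))

/-- Hence the quotient lies in `B_ρ` when `f` does and `ρᵢ > 0`. [folklore] -/
theorem wnorm_quot_lt_top {ρ : σ → ℝ≥0} {i : σ} (hρ : ρ i ≠ 0) {q f : MvPowerSeries σ 𝕜}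
    (hq : ∀ α, coeff α q = coeff (α + single i 1) f) (hf : wnorm ρ f < ⊤) : wnorm ρ q < ⊤ := by
  have h := wnorm_quot_mul_le ρ hq
  have hρ' : (ρ i : ℝ≥0∞) ≠ 0 := ENNReal.coe_ne_zero.2 hρ
  refine lt_of_le_of_lt ((ENNReal.le_div_iff_mul_le (Or.inl hρ') (Or.inl ENNReal.coe_ne_top)).2 h) ?_
  exact ENNReal.div_lt_top hf.ne hρ'

/-- **The restriction is evaluation on the hyperplane**: `f(Xᵢ := 0)(y) = f(y with yᵢ := 0)`
(termwise, no convergence needed). [folklore] -/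
theorem eval_restrict [DecidableEq σ] {i : σ} {r f : MvPowerSeries σ 𝕜}
    (hr : ∀ α, coeff α r = if α i = 0 then coeff α f else 0) (y : σ → 𝕜) :
    eval r y = eval f (update y i 0) := by
  unfold eval
  refine tsum_congr fun α => ?_
  rw [hr α]
  split_ifs with h
  · congr 1
    unfold mono Finsupp.prod
    refine Finset.prod_congr rfl fun j hj => ?_
    have hji : j ≠ i := fun hji => (Finsupp.mem_support_iff.1 hj) (hji ▸ h)
    simp only [update_of_ne hji]
  · rw [zero_mul, mono, Finsupp.prod, Finset.prod_eq_zero (i := i) (Finsupp.mem_support_iff.2 h),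
      mul_zero]
    simp only [Function.update_self, ne_eq, h, not_false_eq_true, zero_pow]

variable [CompleteSpace 𝕜]

/-- **`f(y) = yᵢ · q(y) + f(y₁, …, 0ᵢ, …)`** on the closed polydisc of a finite norm `‖f‖_ρ`
with `ρᵢ > 0`, for a series `q` (the quotient `∑_α f_{α + eᵢ} X^α`) with `‖q‖_ρ ρᵢ ≤ ‖f‖_ρ`.
[cite: GrauertRemmert1971, Kap. I §3] -/
theorem exists_eval_eq_coord_mul_add [DecidableEq σ] {ρ : σ → ℝ≥0} {i : σ} (hρ : ρ i ≠ 0)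
    {f : MvPowerSeries σ 𝕜} (hf : wnorm ρ f < ⊤) :
    ∃ q : MvPowerSeries σ 𝕜, wnorm ρ q * ρ i ≤ wnorm ρ f ∧ wnorm ρ q < ⊤ ∧
      ∀ y : σ → 𝕜, (∀ j, ‖y j‖₊ ≤ ρ j) → eval f y = y i * eval q y + eval f (update y i 0) := by
  obtain ⟨q, r, hq, hr, hf'⟩ := exists_eq_X_mul_add i f
  have hqt := wnorm_quot_lt_top hρ hq hf
  have hX : wnorm ρ (X i : MvPowerSeries σ 𝕜) < ⊤ := by rw [wnorm_X]; exact ENNReal.coe_lt_top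
  have hXq : wnorm ρ (X i * q) < ⊤ := (wnorm_mul_le ρ _ _).trans_lt (ENNReal.mul_lt_top hX hqt)
  have hrt : wnorm ρ r < ⊤ := (wnorm_restrict_le ρ hr).trans_lt hf
  refine ⟨q, wnorm_quot_mul_le ρ hq, hqt, fun y hy => ?_⟩
  conv_lhs => rw [← hf']
  rw [eval_add hy hXq hrt, eval_mul hy hX hqt, eval_X, eval_restrict hr]

end Normed

/-! ### 3. Local and global division of analytic functions by a coordinate -/

section Analytic

variable {ι : Type*} [Fintype ι] [DecidableEq ι] {𝕜 : Type*} [NontriviallyNormedField 𝕜]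

/-- Killing a coordinate does not increase the sup norm. [folklore] -/
theorem norm_update_zero_le (z : ι → 𝕜) (i : ι) : ‖update z i 0‖ ≤ ‖z‖ := by
  refine (pi_norm_le_iff_of_nonneg (norm_nonneg _)).2 fun j => ?_
  by_cases hji : j = i
  · subst hji; rw [Function.update_self, norm_zero]; exact norm_nonneg _
  · rw [update_of_ne hji]; exact norm_le_pi_norm z j

omit [Fintype ι] in
/-- **Values on the hyperplane are determined off it**: two functions continuous at `x` which
agree near `x` at all points `y` with `yᵢ ≠ 0` agree at `x` (approach `x` along the line
`t ↦ (x with xᵢ := t)`, on which `yᵢ = t ≠ 0` for `t` in the punctured neighbourhood of `0`).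
[folklore] -/
theorem eq_of_eventually_eq_off_coord {E : Type*} [TopologicalSpace E] [T2Space E]
    {φ ψ : (ι → 𝕜) → E} {x : ι → 𝕜} (i : ι) (hφ : ContinuousAt φ x) (hψ : ContinuousAt ψ x)
    (h : ∀ᶠ y in 𝓝 x, y i ≠ 0 → φ y = ψ y) : φ x = ψ x := by
  by_cases hx : x i = 0
  · have hγ : Tendsto (fun t : 𝕜 => update x i t) (𝓝 0) (𝓝 x) := by
      have hc : Continuous fun t : 𝕜 => update x i t := continuous_const.update i continuous_id
      have h1 := hc.tendsto (x i)
      rwa [update_eq_self, hx] at h1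
    have hφ' : Tendsto (fun t : 𝕜 => φ (update x i t)) (𝓝[≠] 0) (𝓝 (φ x)) :=
      (hφ.tendsto.comp hγ).mono_left nhdsWithin_le_nhds
    have hψ' : Tendsto (fun t : 𝕜 => ψ (update x i t)) (𝓝[≠] 0) (𝓝 (ψ x)) :=
      (hψ.tendsto.comp hγ).mono_left nhdsWithin_le_nhds
    have heq : (fun t : 𝕜 => φ (update x i t)) =ᶠ[𝓝[≠] 0] fun t => ψ (update x i t) := by
      have h1 : ∀ᶠ t in 𝓝[≠] (0 : 𝕜), (update x i t) i ≠ 0 → φ (update x i t) = ψ (update x i t) :=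
        (hγ.eventually h).filter_mono nhdsWithin_le_nhds
      have h2 : ∀ᶠ t in 𝓝[≠] (0 : 𝕜), t ∈ ({0} : Set 𝕜)ᶜ := eventually_mem_nhdsWithin
      filter_upwards [h1, h2] with t h1 h2
      exact h1 (by rwa [Function.update_self])
    exact tendsto_nhds_unique_of_eventuallyEq hφ' hψ' heq
  · exact h.self_of_nhds hx

variable [CompleteSpace 𝕜]

/-- **Local division by a coordinate.**  If `f` is analytic at a point `p` of the hyperplane
`{xᵢ = 0}` and vanishes on that hyperplane near `p`, then `f = xᵢ · h` near `p` with `h` analytic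
at `p`: expand `f(p + y) = P(y)` in a convergent power series (`OfAnalytic.lean`), split
`P(y) = yᵢ q(y) + P(y with yᵢ := 0)` (`exists_eval_eq_coord_mul_add`), note that the last term is
`f` at a point of the hyperplane, and take `h(x) = q(x - p)` (`analyticAt_eval`).
[cite: GrauertRemmert1971, Kap. I §3] -/
theorem exists_analyticAt_eventually_eq_coord_mul {f : (ι → 𝕜) → 𝕜} {p : ι → 𝕜} {i : ι}
    (hf : AnalyticAt 𝕜 f p) (hp : p i = 0) (h0 : ∀ᶠ x in 𝓝 p, x i = 0 → f x = 0) :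
    ∃ h : (ι → 𝕜) → 𝕜, AnalyticAt 𝕜 h p ∧ ∀ᶠ x in 𝓝 p, f x = x i * h x := by
  obtain ⟨ε, hε, hball⟩ := Metric.eventually_nhds_iff.1 h0
  obtain ⟨pf, r, hpf⟩ := hf
  have hr' : 0 < min r (ENNReal.ofReal ε) := lt_min hpf.r_pos (ENNReal.ofReal_pos.2 hε)
  obtain ⟨P, ρ, hρ, hρr, hw, hev⟩ :=
    exists_wnorm_lt_top_eval_eq_of_hasFPowerSeriesOnBall (hpf.mono hr' (min_le_left _ _))
  have hρε : (ρ : ℝ) < ε := by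
    have h1 : (ρ : ℝ≥0∞) < ENNReal.ofReal ε := lt_of_lt_of_le hρr (min_le_right _ _)
    have h2 := (ENNReal.lt_ofReal_iff_toReal_lt ENNReal.coe_ne_top).1 h1
    simpa using h2
  obtain ⟨q, -, hq, hevq⟩ := exists_eval_eq_coord_mul_add (ρ := fun _ : ι => ρ) (i := i) hρ.ne' hw
  refine ⟨fun x => eval q (x - p), ?_, ?_⟩
  · have h1 : AnalyticAt 𝕜 (eval q) (p - p) := by
      rw [sub_self]
      exact analyticAt_eval hq fun j => by simpa using hρ
    have h2 : AnalyticAt 𝕜 (fun x : ι → 𝕜 => x - p) p := analyticAt_id.fun_sub analyticAt_const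
    exact AnalyticAt.comp (g := eval q) (f := fun x : ι → 𝕜 => x - p) h1 h2
  · have hball' : Metric.ball p ρ ∈ 𝓝 p := Metric.ball_mem_nhds p (by exact_mod_cast hρ)
    filter_upwards [hball'] with x hx
    rw [Metric.mem_ball, dist_eq_norm] at hx
    have hxρ : ∀ j, ‖(x - p) j‖₊ ≤ ρ := fun j =>
      le_of_lt (lt_of_le_of_lt (nnnorm_le_pi_nnnorm (x - p) j) (by exact_mod_cast hx))
    have h1 := hevq (x - p) hxρ
    rw [hev (x - p) hxρ, add_sub_cancel] at h1
    have h2 : ∀ j, ‖update (x - p) i 0 j‖₊ ≤ ρ := by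
      intro j
      by_cases hji : j = i
      · subst hji; simp
      · rw [update_of_ne hji]; exact hxρ j
    have h3 : f (p + update (x - p) i 0) = 0 := by
      refine hball ?_ (by simp [hp])
      rw [dist_eq_norm, add_sub_cancel_left]
      exact lt_of_le_of_lt (norm_update_zero_le _ _) (hx.trans hρε)
    rw [h1, Pi.sub_apply, hp, sub_zero, hev _ h2, h3, add_zero]

/-- **Division by a coordinate on an open set.**  If `f` is analytic on an open set `B` and
vanishes on `B ∩ {xᵢ = 0}`, then `f = xᵢ · h` on `B` with `h` analytic on `B`: off the hyperplane
`h = f / xᵢ`, at its points `h` is the local quotient of `exists_analyticAt_eventually_eq_coord_mul`,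
and the two agree near each hyperplane point by `eq_of_eventually_eq_off_coord`.
[cite: GrauertRemmert1971, Kap. I §3] -/
theorem exists_analyticOnNhd_eq_coord_mul {f : (ι → 𝕜) → 𝕜} {B : Set (ι → 𝕜)} (hB : IsOpen B)
    (hf : AnalyticOnNhd 𝕜 f B) (i : ι) (h0 : ∀ x ∈ B, x i = 0 → f x = 0) :
    ∃ h : (ι → 𝕜) → 𝕜, AnalyticOnNhd 𝕜 h B ∧ ∀ x ∈ B, f x = x i * h x := by
  classical
  have hloc : ∀ p ∈ B, p i = 0 →
      ∃ h : (ι → 𝕜) → 𝕜, AnalyticAt 𝕜 h p ∧ ∀ᶠ x in 𝓝 p, f x = x i * h x := fun p hp hpi =>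
    exists_analyticAt_eventually_eq_coord_mul (hf p hp) hpi
      (Filter.mem_of_superset (hB.mem_nhds hp) fun x hx hxi => h0 x hx hxi)
  choose! H hH hHf using hloc
  refine ⟨fun x => if x i = 0 then H x x else f x / x i, fun p hp => ?_, fun x hx => ?_⟩
  · by_cases hpi : p i = 0
    · have h1 := hHf p hp hpi
      have h2 := (hH p hp hpi).eventually_analyticAt
      have h3 : ∀ᶠ x in 𝓝 p, x ∈ B := hB.mem_nhds hp
      refine (hH p hp hpi).congr ?_
      filter_upwards [h1.eventually_nhds, h2, h3] with x h1x h2x h3x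
      by_cases hxi : x i = 0
      · rw [if_pos hxi]
        refine eq_of_eventually_eq_off_coord i h2x.continuousAt (hH x h3x hxi).continuousAt ?_
        filter_upwards [h1x, hHf x h3x hxi] with y hy1 hy2 hyi
        exact mul_left_cancel₀ hyi (hy1.symm.trans hy2)
      · rw [if_neg hxi, h1x.self_of_nhds, mul_div_cancel_left₀ _ hxi]
    · have hne : ∀ᶠ x in 𝓝 p, x i ≠ 0 := (continuous_apply i).continuousAt.eventually_ne hpi
      have ha : AnalyticAt 𝕜 (fun x => f x / x i) p :=
        (hf p hp).div ((ContinuousLinearMap.proj (R := 𝕜) (φ := fun _ : ι => 𝕜) i).analyticAt p)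
          hpi
      refine ha.congr ?_
      filter_upwards [hne] with x hx
      rw [if_neg hx]
  · beta_reduce
    by_cases hxi : x i = 0
    · rw [h0 x hx hxi, hxi, zero_mul]
    · rw [if_neg hxi, mul_div_cancel₀ _ hxi]

end Analytic

/-! ### 4. Complex-valued real-analytic functions -/

section RealComplex

variable {ι : Type*} [Fintype ι] [DecidableEq ι]

/-- **Division by a coordinate, `ℂ`-valued real-analytic functions.**  If `f : ℝ^ι → ℂ` is
real-analytic on an open set `B` and vanishes on `B ∩ {xᵢ = 0}`, then `f = xᵢ · h` on `B` with
`h : ℝ^ι → ℂ` real-analytic on `B` (apply `exists_analyticOnNhd_eq_coord_mul` to `re f` and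
`im f`). [cite: GrauertRemmert1971, Kap. I §3] -/
theorem exists_analyticOnNhd_eq_ofReal_coord_mul {f : (ι → ℝ) → ℂ} {B : Set (ι → ℝ)}
    (hB : IsOpen B) (hf : AnalyticOnNhd ℝ f B) (i : ι) (h0 : ∀ x ∈ B, x i = 0 → f x = 0) :
    ∃ h : (ι → ℝ) → ℂ, AnalyticOnNhd ℝ h B ∧ ∀ x ∈ B, f x = (x i : ℂ) * h x := by
  obtain ⟨h₁, hh₁, hf₁⟩ := exists_analyticOnNhd_eq_coord_mul hB
    (Complex.reCLM.comp_analyticOnNhd hf) i fun x hx hxi => by simp [h0 x hx hxi]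
  obtain ⟨h₂, hh₂, hf₂⟩ := exists_analyticOnNhd_eq_coord_mul hB
    (Complex.imCLM.comp_analyticOnNhd hf) i fun x hx hxi => by simp [h0 x hx hxi]
  refine ⟨fun x => (h₁ x : ℂ) + (h₂ x : ℂ) * Complex.I, ?_, fun x hx => ?_⟩
  · exact (Complex.ofRealCLM.comp_analyticOnNhd hh₁).add
      ((Complex.ofRealCLM.comp_analyticOnNhd hh₂).mul analyticOnNhd_const)
  · have e1 := hf₁ x hx
    have e2 := hf₂ x hx
    simp only [Function.comp_apply, Complex.reCLM_apply, Complex.imCLM_apply] at e1 e2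
    rw [← Complex.re_add_im (f x), e1, e2]
    push_cast
    ring

end RealComplex

end Literature.RingTheory.MvPowerSeries

end
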